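import Literature.MathematicalPhysics.QuantumFieldTheory.ConformalBootstrap3D.BlockZSeriesAB
import Literature.MathematicalPhysics.QuantumFieldTheory.ConformalBootstrap3D.DiagonalSeriesEnclosure
import Mathlib.Tactic
import HarnessLib

/-!
# End-to-end enclosure of the diagonal of a typed MIXED-channel 3D block

`BlockDiagonalEnclosure.lean` for general external dimensions. For `Δ` strictly above the unitarity bound and
off the accidental degeneracies, ANY `g` with `IsConformalBlock3D Δ₁₂ Δ₃₄ Δ ℓ g` has on the diagonal
`z = z̄ = y ∈ (0,1)` the value of the Dolan–Osborn level series

  `g(y,y) = Σ_n a_n(a,b) y^{Δ+n}`,  `a_n(a,b) = hrLevelSumAB a b Δ ℓ n / λ_ℓ`,  `a = -Δ₁₂/2`, `b = Δ₃₄/2`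

(`IsConformalBlock3D.hasSum_diagAB`, all `(Δ₁₂, Δ₃₄)`; from `BlockZSeriesAB.hasSum_hrLevelAB` at `x = y`),
and for the reflection-positive ordering `Δ₁₂ = -Δ₃₄` (`a = b`; the family `gpm = g^{-Δ_σε,Δ_σε}` of the σ–ε
sum rules 4–5) the coefficients are `≥ 0` (`hrLevelSumAB_self_nonneg`), so the elementary two-sided cell
enclosure of `DiagonalSeriesEnclosure.tsum_rpow_mem_Icc` applies verbatim: for `0 < y ≤ y' < 1`, any `N` and any
`U ≥ g(y',y')`, `S_N(y) ≤ g(y,y) ≤ S_N(y) + (y/y')^{Δ+N+1}(U - S_N(y'))` (`IsConformalBlock3D.diag_mem_Icc_of_neg_eq`),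
plus `g(y,y) ≥ y^Δ/λ_ℓ > 0` and the ratio domination `g(y,y) ≤ (y/y')^Δ g(y',y')`. Elementary assembly of landed
results (Dolan–Osborn 2004 §3 for the series; the enclosure lemmas are folklore). No claim at `Δ = ℓ+1` (a POLE
for `ℓ ≥ 1`, `ab ≠ 0`) or at accidental degeneracies; no sign claim for `Δ₁₂ = Δ₃₄ ≠ 0` (`gmm`, sum rule 3),
for which only the `HasSum` identity is provided. [cite: DolanOsborn2004, §3 eqs. (3.10)–(3.12)]
-/

namespace Literature.MathematicalPhysics.QuantumFieldTheory.ConformalBootstrap3D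

open Set Finset

/-- The diagonal coefficient of `g^{Δ₁₂,Δ₃₄}_{Δ,ℓ}` in the Dolan–Osborn normalisation:
`a_n(a,b) = (Σ_j A_{n,j}(a,b)) / λ_ℓ`. [cite: DolanOsborn2004, §3 eq. (3.10)] -/
noncomputable def hrDiagCoeffAB (a b Δ : ℝ) (ℓ n : ℕ) : ℝ := hrLevelSumAB a b Δ ℓ n / legendreLam ℓ

/-- `a_n(a,a) ≥ 0` above the unitarity bound. [cite: DolanOsborn2004, §3 eq. (3.11)] -/
theorem hrDiagCoeffAB_self_nonneg {Δ : ℝ} {ℓ : ℕ} (a : ℝ) (hΔ : unitarityBound3D ℓ < Δ) (n : ℕ) :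
    0 ≤ hrDiagCoeffAB a a Δ ℓ n :=
  div_nonneg (hrLevelSumAB_self_nonneg a hΔ n) (legendreLam_pos ℓ).le

/-- The level-zero sum is `1` (`A_{0,j} = δ_{jℓ}`), for every `(a,b)`. [cite: DolanOsborn2004, §3 eq. (3.13)] -/
theorem hrLevelSumAB_zero (a b Δ : ℝ) (ℓ : ℕ) : hrLevelSumAB a b Δ ℓ 0 = 1 := by
  unfold hrLevelSumAB
  rw [Finset.sum_eq_single ℓ]
  · simp
  · intro j _ hj
    exact hrCoeffAB_zero_of_ne a b Δ hj
  · intro h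
    exact absurd (Finset.mem_range.mpr (by omega)) h

/-- `a_0 = 1/λ_ℓ`. [cite: DolanOsborn2004, §3 eq. (3.13)] -/
theorem hrDiagCoeffAB_zero (a b Δ : ℝ) (ℓ : ℕ) : hrDiagCoeffAB a b Δ ℓ 0 = 1 / legendreLam ℓ := by
  rw [hrDiagCoeffAB, hrLevelSumAB_zero]

/-- `a_0 > 0`. [cite: DolanOsborn2004, §3 eq. (3.13)] -/
theorem hrDiagCoeffAB_zero_pos (a b Δ : ℝ) (ℓ : ℕ) : 0 < hrDiagCoeffAB a b Δ ℓ 0 := by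
  rw [hrDiagCoeffAB_zero]; exact div_pos one_pos (legendreLam_pos ℓ)

/-- The truncated diagonal series `S_N(y) = Σ_{n ≤ N} a_n(a,b) y^{Δ+n}`. [cite: DolanOsborn2004, §3 eq. (3.10)] -/
noncomputable def hrDiagPartialSumAB (a b Δ : ℝ) (ℓ N : ℕ) (y : ℝ) : ℝ :=
  ∑ n ∈ range (N + 1), hrDiagCoeffAB a b Δ ℓ n * y ^ (Δ + n)

/-- On the diagonal the level-`n` sum of the `z`-series is `a_n(a,b) y^{Δ+n}` (`𝒫_{Δ+n,j}(y,y) = y^{Δ+n}`).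
[cite: DolanOsborn2004, §3 eq. (3.10)] -/
theorem hrLevelAB_diag (a b Δ : ℝ) (ℓ : ℕ) {y : ℝ} (hy : 0 < y) (n : ℕ) :
    hrLevelAB a b Δ ℓ y y n = hrDiagCoeffAB a b Δ ℓ n * y ^ (Δ + n) := by
  unfold hrLevelAB hrZTermAB hrDiagCoeffAB hrLevelSumAB
  rw [Finset.sum_div, Finset.sum_mul]
  refine Finset.sum_congr rfl fun j _ => ?_
  simp only
  rw [zMono_diag _ _ hy]

/-- **The diagonal of a typed mixed-channel block IS the Dolan–Osborn level series** (all `(Δ₁₂, Δ₃₄)`).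
[cite: DolanOsborn2004, §3 eqs. (3.10)–(3.12)] -/
theorem IsConformalBlock3D.hasSum_diagAB {Δ₁₂ Δ₃₄ Δ : ℝ} {ℓ : ℕ} {g : ℝ → ℝ → ℝ}
    (hΔ : unitarityBound3D ℓ < Δ) (hreg : ¬ accidentalDegeneracy3D Δ ℓ)
    (h : IsConformalBlock3D Δ₁₂ Δ₃₄ Δ ℓ g) {y : ℝ} (hy : y ∈ Ioo (0 : ℝ) 1) :
    HasSum (fun n : ℕ => hrDiagCoeffAB (-Δ₁₂ / 2) (Δ₃₄ / 2) Δ ℓ n * y ^ (Δ + n)) (g y y) := by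
  have h1 := h.hasSum_hrLevelAB hΔ hreg hy hy
  have hfun : hrLevelAB (-Δ₁₂ / 2) (Δ₃₄ / 2) Δ ℓ y y =
      fun n : ℕ => hrDiagCoeffAB (-Δ₁₂ / 2) (Δ₃₄ / 2) Δ ℓ n * y ^ (Δ + n) :=
    funext fun n => hrLevelAB_diag _ _ Δ ℓ hy.1 n
  rwa [hfun] at h1

/-- The diagonal value as a `tsum` (all `(Δ₁₂, Δ₃₄)`). [cite: DolanOsborn2004, §3 eq. (3.10)] -/
theorem IsConformalBlock3D.diag_eq_tsumAB {Δ₁₂ Δ₃₄ Δ : ℝ} {ℓ : ℕ} {g : ℝ → ℝ → ℝ}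
    (hΔ : unitarityBound3D ℓ < Δ) (hreg : ¬ accidentalDegeneracy3D Δ ℓ)
    (h : IsConformalBlock3D Δ₁₂ Δ₃₄ Δ ℓ g) {y : ℝ} (hy : y ∈ Ioo (0 : ℝ) 1) :
    g y y = ∑' n : ℕ, hrDiagCoeffAB (-Δ₁₂ / 2) (Δ₃₄ / 2) Δ ℓ n * y ^ (Δ + n) :=
  (h.hasSum_diagAB hΔ hreg hy).tsum_eq.symm

/-! ### The reflection-positive ordering `Δ₁₂ = -Δ₃₄`: two-sided cell enclosure -/

section NegEq

variable {Δ₁₂ Δ₃₄ Δ : ℝ} {ℓ : ℕ} {g : ℝ → ℝ → ℝ}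

/-- For `Δ₁₂ = -Δ₃₄` the diagonal series has the non-negative coefficients `a_n(a,a)`, `a = Δ₃₄/2`.
[cite: DolanOsborn2004, §3 eq. (3.11)] -/
theorem IsConformalBlock3D.hasSum_diag_of_neg_eq (hΔ : unitarityBound3D ℓ < Δ)
    (hreg : ¬ accidentalDegeneracy3D Δ ℓ) (hab : Δ₁₂ = -Δ₃₄) (h : IsConformalBlock3D Δ₁₂ Δ₃₄ Δ ℓ g)
    {y : ℝ} (hy : y ∈ Ioo (0 : ℝ) 1) :
    HasSum (fun n : ℕ => hrDiagCoeffAB (Δ₃₄ / 2) (Δ₃₄ / 2) Δ ℓ n * y ^ (Δ + n)) (g y y) := by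
  have h1 := h.hasSum_diagAB hΔ hreg hy
  have h12 : -Δ₁₂ / 2 = Δ₃₄ / 2 := by rw [hab]; ring
  rwa [h12] at h1

/-- Summability of the diagonal series (`Δ₁₂ = -Δ₃₄`). [cite: DolanOsborn2004, §3 eq. (3.11)] -/
theorem IsConformalBlock3D.summable_diag_of_neg_eq (hΔ : unitarityBound3D ℓ < Δ)
    (hreg : ¬ accidentalDegeneracy3D Δ ℓ) (hab : Δ₁₂ = -Δ₃₄) (h : IsConformalBlock3D Δ₁₂ Δ₃₄ Δ ℓ g)
    {y : ℝ} (hy : y ∈ Ioo (0 : ℝ) 1) :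
    Summable fun n : ℕ => hrDiagCoeffAB (Δ₃₄ / 2) (Δ₃₄ / 2) Δ ℓ n * y ^ (Δ + n) :=
  (h.hasSum_diag_of_neg_eq hΔ hreg hab hy).summable

/-- The diagonal value as a `tsum` (`Δ₁₂ = -Δ₃₄`). [cite: DolanOsborn2004, §3 eq. (3.11)] -/
theorem IsConformalBlock3D.diag_eq_tsum_of_neg_eq (hΔ : unitarityBound3D ℓ < Δ)
    (hreg : ¬ accidentalDegeneracy3D Δ ℓ) (hab : Δ₁₂ = -Δ₃₄) (h : IsConformalBlock3D Δ₁₂ Δ₃₄ Δ ℓ g)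
    {y : ℝ} (hy : y ∈ Ioo (0 : ℝ) 1) :
    g y y = ∑' n : ℕ, hrDiagCoeffAB (Δ₃₄ / 2) (Δ₃₄ / 2) Δ ℓ n * y ^ (Δ + n) :=
  (h.hasSum_diag_of_neg_eq hΔ hreg hab hy).tsum_eq.symm

/-- **Lower bounds** (`Δ₁₂ = -Δ₃₄`): every truncation is a lower bound, `S_N(y) ≤ g(y,y)`.
[cite: DolanOsborn2004, §3 eq. (3.11)] -/
theorem IsConformalBlock3D.partialSum_le_diag_of_neg_eq (hΔ : unitarityBound3D ℓ < Δ)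
    (hreg : ¬ accidentalDegeneracy3D Δ ℓ) (hab : Δ₁₂ = -Δ₃₄) (h : IsConformalBlock3D Δ₁₂ Δ₃₄ Δ ℓ g)
    {y : ℝ} (hy : y ∈ Ioo (0 : ℝ) 1) (N : ℕ) :
    hrDiagPartialSumAB (Δ₃₄ / 2) (Δ₃₄ / 2) Δ ℓ N y ≤ g y y := by
  rw [h.diag_eq_tsum_of_neg_eq hΔ hreg hab hy]
  exact partialSum_le_tsum_rpow (hrDiagCoeffAB_self_nonneg _ hΔ) hy.1.le
    (h.summable_diag_of_neg_eq hΔ hreg hab hy) N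

/-- Positivity on the diagonal (`Δ₁₂ = -Δ₃₄`). [cite: DolanOsborn2004, §3 eq. (3.11)] -/
theorem IsConformalBlock3D.diag_pos_of_neg_eq (hΔ : unitarityBound3D ℓ < Δ)
    (hreg : ¬ accidentalDegeneracy3D Δ ℓ) (hab : Δ₁₂ = -Δ₃₄) (h : IsConformalBlock3D Δ₁₂ Δ₃₄ Δ ℓ g)
    {y : ℝ} (hy : y ∈ Ioo (0 : ℝ) 1) : 0 < g y y := by
  rw [h.diag_eq_tsum_of_neg_eq hΔ hreg hab hy]
  exact tsum_rpow_pos (hrDiagCoeffAB_self_nonneg _ hΔ) (hrDiagCoeffAB_zero_pos _ _ Δ ℓ) hy.1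
    (h.summable_diag_of_neg_eq hΔ hreg hab hy)

/-- **Ratio domination along the diagonal** (`Δ₁₂ = -Δ₃₄`): for `0 < y ≤ y' < 1`,
`g(y,y) ≤ (y/y')^Δ g(y',y')`. [cite: DolanOsborn2004, §3 eq. (3.11)] -/
theorem IsConformalBlock3D.diag_ratio_le_of_neg_eq (hΔ : unitarityBound3D ℓ < Δ)
    (hreg : ¬ accidentalDegeneracy3D Δ ℓ) (hab : Δ₁₂ = -Δ₃₄) (h : IsConformalBlock3D Δ₁₂ Δ₃₄ Δ ℓ g)
    {y y' : ℝ} (hy : 0 < y) (hyy' : y ≤ y') (hy'1 : y' < 1) :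
    g y y ≤ (y / y') ^ Δ * g y' y' := by
  have hyI : y ∈ Ioo (0 : ℝ) 1 := ⟨hy, lt_of_le_of_lt hyy' hy'1⟩
  have hy'I : y' ∈ Ioo (0 : ℝ) 1 := ⟨lt_of_lt_of_le hy hyy', hy'1⟩
  rw [h.diag_eq_tsum_of_neg_eq hΔ hreg hab hyI, h.diag_eq_tsum_of_neg_eq hΔ hreg hab hy'I]
  exact tsum_rpow_ratio_le (hrDiagCoeffAB_self_nonneg _ hΔ) hy hyy'
    (h.summable_diag_of_neg_eq hΔ hreg hab hy'I)

/-- **End-to-end cell enclosure of a typed reflection-positive mixed block on the diagonal.** For `Δ`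
strictly above the unitarity bound and off the accidental degeneracies, `Δ₁₂ = -Δ₃₄`, `g` any function with
`IsConformalBlock3D Δ₁₂ Δ₃₄ Δ ℓ g`, `0 < y ≤ y' < 1`, a truncation order `N` and an upper bound `U ≥ g(y',y')`:
`g(y,y) ∈ [S_N(y), S_N(y) + (y/y')^{Δ+N+1} (U − S_N(y'))]`. Both endpoints are finite closed-form expressions in
`(Δ, Δ₃₄, ℓ, N, y, y', U)`, polynomial in `Δ₃₄`. [cite: DolanOsborn2004, §3 eqs. (3.10)–(3.12)] -/
theorem IsConformalBlock3D.diag_mem_Icc_of_neg_eq (hΔ : unitarityBound3D ℓ < Δ)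
    (hreg : ¬ accidentalDegeneracy3D Δ ℓ) (hab : Δ₁₂ = -Δ₃₄) (h : IsConformalBlock3D Δ₁₂ Δ₃₄ Δ ℓ g)
    {y y' U : ℝ} (hy : 0 < y) (hyy' : y ≤ y') (hy'1 : y' < 1) (N : ℕ) (hU : g y' y' ≤ U) :
    g y y ∈ Icc (hrDiagPartialSumAB (Δ₃₄ / 2) (Δ₃₄ / 2) Δ ℓ N y)
      (hrDiagPartialSumAB (Δ₃₄ / 2) (Δ₃₄ / 2) Δ ℓ N y +
        (y / y') ^ (Δ + N + 1) * (U - hrDiagPartialSumAB (Δ₃₄ / 2) (Δ₃₄ / 2) Δ ℓ N y')) := by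
  have hyI : y ∈ Ioo (0 : ℝ) 1 := ⟨hy, lt_of_le_of_lt hyy' hy'1⟩
  have hy'I : y' ∈ Ioo (0 : ℝ) 1 := ⟨lt_of_lt_of_le hy hyy', hy'1⟩
  have hU' : ∑' n : ℕ, hrDiagCoeffAB (Δ₃₄ / 2) (Δ₃₄ / 2) Δ ℓ n * y' ^ (Δ + n) ≤ U := by
    rw [← h.diag_eq_tsum_of_neg_eq hΔ hreg hab hy'I]; exact hU
  rw [h.diag_eq_tsum_of_neg_eq hΔ hreg hab hyI]
  exact tsum_rpow_mem_Icc (hrDiagCoeffAB_self_nonneg _ hΔ) hy hyy'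
    (h.summable_diag_of_neg_eq hΔ hreg hab hy'I) N hU'

/-- **Self-bounding form**: `g(y,y) ≤ S_N(y) + (y/y')^{Δ+N+1} (g(y',y') − S_N(y'))` (`Δ₁₂ = -Δ₃₄`).
[cite: DolanOsborn2004, §3 eq. (3.11)] -/
theorem IsConformalBlock3D.diag_le_partialSum_add_tail_of_neg_eq (hΔ : unitarityBound3D ℓ < Δ)
    (hreg : ¬ accidentalDegeneracy3D Δ ℓ) (hab : Δ₁₂ = -Δ₃₄) (h : IsConformalBlock3D Δ₁₂ Δ₃₄ Δ ℓ g)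
    {y y' : ℝ} (hy : 0 < y) (hyy' : y ≤ y') (hy'1 : y' < 1) (N : ℕ) :
    g y y ≤ hrDiagPartialSumAB (Δ₃₄ / 2) (Δ₃₄ / 2) Δ ℓ N y
      + (y / y') ^ (Δ + N + 1) * (g y' y' - hrDiagPartialSumAB (Δ₃₄ / 2) (Δ₃₄ / 2) Δ ℓ N y') :=
  (h.diag_mem_Icc_of_neg_eq hΔ hreg hab hy hyy' hy'1 N le_rfl).2

end NegEq

end Literature.MathematicalPhysics.QuantumFieldTheory.ConformalBootstrap3D
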